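import Summits.AtomisticToContinuum.Crystallization.Theorems.GappedShellCensusRadialDefectsVanishLocallyTwelveGap

/-!
# SKELETON rev 2 — crux `GappedShellCensus.RadialDefectsVanish` (stmt-AtomisticToContinuum-15930), line `locally-twelve-gap`
# (crux-strategist s2, 2026-08-17; ADOPTED as the LIVE line by lead c2 at 09:40Z — PICKED.md; Sketch rev 3b stays on record).
# Rev 2 (lead c2): the composition and the child-emptying lemma are LANDED (p151785,
# Theorems/GappedShellCensusRadialDefectsVanishLocallyTwelveGap.lean: `radialDefectsVanish_of_locallyTwelveGap` (registered stub),
# `radialDefectsVanish_of_locallyTwelveGapAt` (any radius R ≥ 0), `RdvLtg.gapBeyondTwelveAt_of_locallyTwelveGapAt`, cap lemma H1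
# `RdvLtg.inner_le_of_annulus`), so this file is the three stubs + a one-line `RadialDefectsVanish_of`.

The live skeleton (Sketch rev 3b) has NO stub of its own: its three stubs are, verbatim, the hub item
stmt-AtomisticToContinuum-15808, the Literature named fact `musinTarasov2012_tammes_thirteen`, and the UNFILED split child
`GapBeyondTwelve` (a statement about true Lennard-Jones minimisers) — hence the stall.  This line keeps the two foreign stubs
(same names, same registered signatures) and REPLACES the third by an OWN, ground-state-free, FINITE geometric lemma:

* `stub_locallyTwelveGap` (NEW, this line's own; pure discrete geometry, L-sized, certifiable): in ANY finite configuration of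
  points of `ℝ³`, a site `i` that is LOCALLY TWELVE OUT TO `7/2` (every site within `7/2` of `x_i`, `x_i` included, has a
  `55/57`-separated `11/10`-neighbourhood and EXACTLY twelve other sites within distance `1`) has NO other site at distance in
  the open annulus `(1, 21/17)`.  This is the k-centre, `3.5 %`-tolerant form of Hales' 2012 lemma "kissing number twelve
  everywhere ⇒ no centre distance in `(2, 2.52)`" (tolerance `0`); its ONE-centre version is FALSE (a 13th point fits at every
  radius `≥ 1.113` when only the centre is twelve-coordinated — STRATEGY-CENSUS N4/N6, Disproof.lean), its TWO-shell version
  is numerically robust (kit j021710: centre + its twelve shell atoms twelve-coordinated ⇒ 0/163 feasible, best miss 5–9 %;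
  kit j021682: periodic cells ≤ 5 atoms clear the annulus by 6.3 %).  The hypothesis radius `7/2` matches the split child and
  the landed glue; any certificate for a smaller hypothesis radius (the two-shell cluster, ≤ 57 points) proves it a fortiori.
* `gapBeyondTwelve_of_locallyTwelveGap` (PROVED here): the own stub EMPTIES the bad set of the split child `GapBeyondTwelve`
  for every `N` (no ground-state hypothesis, no `θ`), so the child holds trivially.
* `RadialDefectsVanish_of` (PROVED here, the crux BY NAME): through the landed `radialDefectsVanish_of_tammes`
  (Theorems/GappedShellCensusRadialDefectsVanishSplit.lean, p136458: Tammes-13 fact → TwelveWithinOne → GapBeyondTwelve → crux,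
  scale `a = 50/51`).

Sorries: exactly the three `stub_*`.  Honest residue of the crux on this line: item 15808 (energy, one-sided; its own line is
closed modulo 9225 ∧ 9226) ∧ the Tammes-13 named fact ∧ ONE finite geometric certificate.
Disproof used (Cruxes/RadialDefectsVanish/Disproof.lean, cdisprove gen2 final): §1–2 the scale is SELECTED (a = 50/51 inside
`radialDefectsVanish_of_tammes`), §6 minimality is load-bearing (spent inside `stub_twelveWithinOne` only — the geometric stub is
GS-free by design, cf. `radialDefectsVanish_false_without_GS`: the dilated-line witness is not locally twelve), N4/N6 one-centre
tolerant L12 is false (so the stub's k-centre hypothesis is load-bearing and kept at radius 7/2).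
-/

noncomputable section

open scoped BigOperators Topology Classical
open Filter Finset
open Literature.MathematicalPhysics.StatisticalMechanics
open Literature.Geometry.DiscreteGeometry (musinTarasov2012_tammes_thirteen)

namespace Summit.AtomisticToContinuum.Crystallization.Cruxes.RadialDefectsVanish.LocallyTwelveGap

/-! ## The registered stubs -/

/-- STUB 1 (foreign: = hub item stmt-AtomisticToContinuum-15808 `SquareWellLayerCake.TwelveWithinOne`, verbatim; ENERGY,
one-sided; registered on stmt-15930 under this name since Sketch rev 3). -/
theorem stub_twelveWithinOne : ∀ x : (N : ℕ) → (Fin N → EuclideanSpace ℝ (Fin 3)), (∀ N, Literature.MathematicalPhysics.StatisticalMechanics.IsGroundState Literature.MathematicalPhysics.StatisticalMechanics.lennardJones (x N)) → Filter.Tendsto (fun N : ℕ => (Nat.card {i : Fin N // ¬ ((∀ j : Fin N, dist (x N i) (x N j) ≤ 11 / 10 → ∀ k : Fin N, k ≠ j → (55 : ℝ) / 57 ≤ dist (x N j) (x N k)) ∧ 12 ≤ (Finset.univ.filter fun j : Fin N => j ≠ i ∧ dist (x N i) (x N j) ≤ 1).card)} : ℝ) / N) Filter.atTop (nhds 0)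 := by
  sorry

/-- STUB 2 (foreign: = the Literature named fact `musinTarasov2012_tammes_thirteen`, Musin–Tarasov 2012 Thm 1; registered on
stmt-15930 under this name since Sketch rev 3). -/
theorem stub_tammesThirteen : musinTarasov2012_tammes_thirteen := by
  sorry

/-- STUB 3 (OWN, NEW — `LocallyTwelveGap`, the k-centre tolerant Hales gap; pure finite geometry, GS-free):
a site that is locally twelve out to `7/2` has no neighbour at distance in `(1, 21/17)`. [difficulty: L, certified computation] -/
theorem stub_locallyTwelveGap : ∀ (N : ℕ) (X : Fin N → EuclideanSpace ℝ (Fin 3)) (i : Fin N),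
    (∀ j : Fin N, dist (X i) (X j) ≤ 7 / 2 →
      (∀ k : Fin N, dist (X j) (X k) ≤ 11 / 10 → ∀ l : Fin N, l ≠ k → (55 : ℝ) / 57 ≤ dist (X k) (X l)) ∧
      (Finset.univ.filter fun k : Fin N => k ≠ j ∧ dist (X j) (X k) ≤ 1).card = 12) →
    ∀ j : Fin N, j ≠ i → dist (X i) (X j) ≤ 1 ∨ (21 : ℝ) / 17 ≤ dist (X i) (X j) := by
  sorry

/-! ## Composition -/

/-- **The crux BY NAME from the three stubs** through the landed `radialDefectsVanish_of_locallyTwelveGap` (p151785; inside it: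
the own stub empties the split child `GapBeyondTwelve` for every `N`, then `radialDefectsVanish_of_tammes`, p136458, scale a = 50/51). -/
theorem RadialDefectsVanish_of :
    Summit.AtomisticToContinuum.Crystallization.Theses.GappedShellCensus.RadialDefectsVanish :=
  Summit.AtomisticToContinuum.Crystallization.Theorems.radialDefectsVanish_of_locallyTwelveGap stub_tammesThirteen
    stub_twelveWithinOne stub_locallyTwelveGap

end Summit.AtomisticToContinuum.Crystallization.Cruxes.RadialDefectsVanish.LocallyTwelveGap

end
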